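import Mathlib
import Summits.KontsevichZagierPeriods.KontsevichZagierPeriods.Theorems.SoloInformedNashChain
import Summits.KontsevichZagierPeriods.KontsevichZagierPeriods.Theorems.SoloInformedKappaHomotopy
import HarnessLib

/-!
# SoloInformed — Nash chains: the vertex-slide homotopy

File H3a of the Nash-replacement construction (APPROX) of `paper/rung2-v2.md` §4.4.
Given a chain of charts on `Z` and two admissible vertex families `v`, `q` with the same end
vertices such that, for `0 < r < N`, the image under `ψ_r` of the chord from `(v_r)_{i_r}` to
`(q_r)_{i_r}` stays inside `Ω_{r−1}`, the *vertex slide* `m_r(s) = ψ_r(segPoint (v_r)_{i_r}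
(q_r)_{i_r} s)` is an admissible family for every `s`, and `(s, t) ↦ Γ_{m(s)}(t)` is a homotopy
on `Z(ℂ)` with fixed endpoints from the chordal path `Γ_v` to `Γ_q`
(`SoloInformedChain.homotopic_slide`). The gluing of consecutive pieces during the slide is
automatic: it is the graph property of the charts, built into `Γ`. We also record the
packaging of a continuous fixed-endpoint homotopy of `CurvePath`s on `Z(ℂ)` as
`SoloInformedHomotopic` (`soloInformed_homotopic_of_homotopy`). Reference: Huber–Wüstholz 2022,
§3.3.1 (homotopy invariance of curve periods is what this feeds, via (HT)).
-/

noncomputable section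

open Set Metric
open scoped unitInterval
open Literature.NumberTheory.Transcendental Literature.NumberTheory.Transcendental.KZ
open Literature.NumberTheory.Transcendental.CurvePeriods

namespace Summit.KontsevichZagierPeriods.KontsevichZagierPeriods.Theorems

variable {Z : CurveData}

/-! ### Packaging homotopies -/

/-- **Packaging.** Two `CurvePath`s joined by a continuous homotopy on `Z(ℂ)` with fixed
endpoints are `SoloInformedHomotopic`. -/
theorem soloInformed_homotopic_of_homotopy (γ₀ γ₁ : CurvePath Z) (K : ℝ × ℝ → Fin Z.n → ℂ)
    (hKc : Continuous K) (hKZ : ∀ s, ∀ t ∈ Icc (0 : ℝ) 1, K (s, t) ∈ Z.points)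
    (hK0 : ∀ t ∈ Icc (0 : ℝ) 1, K (0, t) = γ₀.toFun t)
    (hK1 : ∀ t ∈ Icc (0 : ℝ) 1, K (1, t) = γ₁.toFun t)
    (hKs0 : ∀ s, K (s, 0) = γ₀.toFun 0) (hKs1 : ∀ s, K (s, 1) = γ₀.toFun 1) :
    SoloInformedHomotopic γ₀ γ₁ := by
  have hI0 : (0 : ℝ) ∈ Icc (0 : ℝ) 1 := ⟨le_rfl, zero_le_one⟩
  have hI1 : (1 : ℝ) ∈ Icc (0 : ℝ) 1 := ⟨zero_le_one, le_rfl⟩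
  have h10 : γ₁.toFun 0 = γ₀.toFun 0 := by rw [← hK1 0 hI0, hKs0]
  have h11 : γ₁.toFun 1 = γ₀.toFun 1 := by rw [← hK1 1 hI1, hKs1]
  let x : Z.points := ⟨γ₀.toFun 0, γ₀.mem_points 0 hI0⟩
  let y : Z.points := ⟨γ₀.toFun 1, γ₀.mem_points 1 hI1⟩
  have hc (γ : CurvePath Z) : Continuous fun t : I => γ.toFun t :=
    γ.contDiffOn.continuousOn.comp_continuous continuous_subtype_val fun t => t.2
  let p₀ : Path x y :=
    { toFun := fun t => ⟨γ₀.toFun t, γ₀.mem_points t t.2⟩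
      continuous_toFun := (hc γ₀).subtype_mk _
      source' := rfl
      target' := rfl }
  let p₁ : Path x y :=
    { toFun := fun t => ⟨γ₁.toFun t, γ₁.mem_points t t.2⟩
      continuous_toFun := (hc γ₁).subtype_mk _
      source' := Subtype.ext h10
      target' := Subtype.ext h11 }
  let F : Path.Homotopy p₀ p₁ :=
    { toFun := fun st => ⟨K (st.1, st.2), hKZ _ _ st.2.2⟩
      continuous_toFun := (hKc.comp ((continuous_subtype_val.comp continuous_fst).prodMk
        (continuous_subtype_val.comp continuous_snd))).subtype_mk _
      map_zero_left := fun t => Subtype.ext (by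
        show K (0, t) = γ₀.toFun t
        exact hK0 t t.2)
      map_one_left := fun t => Subtype.ext (by
        show K (1, t) = γ₁.toFun t
        exact hK1 t t.2)
      prop' := fun s t ht => by
        show (⟨K (s, t), _⟩ : Z.points) = p₀ t
        rcases ht with ht | ht
        · rw [ht]
          exact Subtype.ext (hKs0 s)
        · rw [Set.mem_singleton_iff] at ht
          rw [ht]
          exact Subtype.ext (hKs1 s) }
  exact ⟨x, y, p₀, p₁, fun _ => rfl, fun _ => rfl, ⟨F⟩⟩

/-! ### The clamp `[0, 1]` -/

/-- The clamp of `ℝ` onto `[0, 1]`. -/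
def soloInformedClamp (s : ℝ) : ℝ := max 0 (min s 1)

/-- The clamp takes values in `[0, 1]`. -/
theorem soloInformedClamp_mem (s : ℝ) : soloInformedClamp s ∈ Icc (0 : ℝ) 1 :=
  ⟨le_max_left _ _, max_le zero_le_one (min_le_right _ _)⟩

/-- The clamp at `0`. -/
@[simp] theorem soloInformedClamp_zero : soloInformedClamp 0 = 0 := by norm_num [soloInformedClamp]

/-- The clamp at `1`. -/
@[simp] theorem soloInformedClamp_one : soloInformedClamp 1 = 1 := by norm_num [soloInformedClamp]

/-- The clamp is continuous. -/
theorem continuous_soloInformedClamp : Continuous soloInformedClamp :=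
  continuous_const.max (continuous_id.min continuous_const)

/-- `segPoint` is jointly continuous in its three arguments. -/
theorem soloInformed_continuous_segPoint {X : Type*} [TopologicalSpace X] {a b : X → ℂ}
    {u : X → ℝ} (ha : Continuous a) (hb : Continuous b) (hu : Continuous u) :
    Continuous fun p => segPoint (a p) (b p) (u p) := by
  unfold segPoint
  exact ((Complex.continuous_ofReal.comp (continuous_const.sub hu)).mul ha).add
    ((Complex.continuous_ofReal.comp hu).mul hb)

namespace SoloInformedChain

variable (C : SoloInformedChain Z) {x y v q : ℕ → Fin Z.n → ℂ}

/-- The chordal path only depends on the vertices `x_r`, `r ≤ N`. -/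
theorem gamma_congr (h : ∀ r ≤ C.N, x r = y r) : C.gamma x = C.gamma y := by
  funext t
  unfold gamma piece
  rw [h 0 (Nat.zero_le _)]
  refine congrArg _ (Finset.sum_congr rfl fun r hr => ?_)
  have hr' : r < C.N := Finset.mem_range.mp hr
  rw [h r hr'.le, h (r + 1) hr']

/-! ### The vertex slide -/

/-- The sliding vertex family `m(s)`: `ψ_r` of the chord point between the coordinates of `v_r`
and `q_r` for `r < N`, and `v_r` for `r ≥ N`. -/
def slideVerts (v q : ℕ → Fin Z.n → ℂ) (s : ℝ) (r : ℕ) : Fin Z.n → ℂ :=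
  if r < C.N then
    (C.chart r).ψ (segPoint (v r (C.chart r).i₀) (q r (C.chart r).i₀) (soloInformedClamp s))
  else v r

/-- The slide condition: for `0 < r < N` the image of the chord stays inside `Ω_{r−1}`. -/
def SlideOK (v q : ℕ → Fin Z.n → ℂ) : Prop :=
  ∀ r, 0 < r → r < C.N → ∀ u ∈ Icc (0 : ℝ) 1,
    (C.chart r).ψ (segPoint (v r (C.chart r).i₀) (q r (C.chart r).i₀) u) ∈ (C.chart (r - 1)).Ω

/-- The chord point of the slide lies in the disc `B_r`. -/
theorem slide_chord_mem (hv : C.Adm v) (hq : C.Adm q) {r : ℕ} (hr : r < C.N) (u : ℝ)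
    (hu : u ∈ Icc (0 : ℝ) 1) :
    segPoint (v r (C.chart r).i₀) (q r (C.chart r).i₀) u ∈ ball (C.chart r).w₀ (C.chart r).ε :=
  segPoint_mem (convex_ball _ _) (C.chord_mem hv hr).1 (C.chord_mem hq hr).1 hu

/-- The sliding vertices for `r < N`, unfolded. -/
theorem slideVerts_of_lt (s : ℝ) {r : ℕ} (hr : r < C.N) : C.slideVerts v q s r =
    (C.chart r).ψ (segPoint (v r (C.chart r).i₀) (q r (C.chart r).i₀) (soloInformedClamp s)) :=
  if_pos hr

/-- The sliding vertices for `N ≤ r`. -/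
theorem slideVerts_of_le (s : ℝ) {r : ℕ} (hr : C.N ≤ r) : C.slideVerts v q s r = v r :=
  if_neg (not_lt.mpr hr)

/-- **The sliding family is admissible** for every `s`. -/
theorem adm_slideVerts (hv : C.Adm v) (hq : C.Adm q) (hS : C.SlideOK v q) (s : ℝ) :
    C.Adm (C.slideVerts v q s) := by
  have hri {r : ℕ} (hr : r < C.N) := (C.chart r).right_inv _
    (C.slide_chord_mem hv hq hr _ (soloInformedClamp_mem s))
  refine ⟨fun r hr => ?_, fun r hr => ?_, fun r hr => ?_⟩
  · rcases hr.lt_or_eq with hr | rfl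
    · rw [C.slideVerts_of_lt s hr]; exact (hri hr).2.1
    · rw [C.slideVerts_of_le s le_rfl]; exact hv.mem _ le_rfl
  · rw [C.slideVerts_of_lt s hr]; exact (hri hr).1
  · by_cases h : r + 1 < C.N
    · rw [C.slideVerts_of_lt s h]
      simpa using hS (r + 1) (Nat.succ_pos r) h _ (soloInformedClamp_mem s)
    · rw [C.slideVerts_of_le s (not_lt.mp h)]; exact hv.memΩ' r hr

/-- At `s = 0` the sliding family is `v`. -/
theorem slideVerts_zero (hv : C.Adm v) : C.slideVerts v q 0 = v := by
  funext r
  by_cases hr : r < C.N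
  · rw [C.slideVerts_of_lt 0 hr, soloInformedClamp_zero, segPoint_zero]
    exact (C.chart r).apply_coord (hv.memΩ r hr) (hv.mem r hr.le)
  · exact C.slideVerts_of_le 0 (not_lt.mp hr)

/-- At `s = 1` the sliding family is `q` on `r ≤ N` (given `q_N = v_N`). -/
theorem slideVerts_one (hq : C.Adm q) (hN : q C.N = v C.N) :
    ∀ r ≤ C.N, C.slideVerts v q 1 r = q r := by
  intro r hr
  rcases hr.lt_or_eq with hr | rfl
  · rw [C.slideVerts_of_lt 1 hr, soloInformedClamp_one, segPoint_one]
    exact (C.chart r).apply_coord (hq.memΩ r hr) (hq.mem r hr.le)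
  · rw [C.slideVerts_of_le 1 le_rfl, hN]

/-- The sliding vertices move continuously. -/
theorem continuous_slideVerts (hv : C.Adm v) (hq : C.Adm q) (r : ℕ) :
    Continuous fun s => C.slideVerts v q s r := by
  by_cases hr : r < C.N
  · simp only [C.slideVerts_of_lt _ hr]
    exact (C.chart r).continuousOn.comp_continuous
      (soloInformed_continuous_segPoint continuous_const continuous_const
        continuous_soloInformedClamp)
      fun s => C.slide_chord_mem hv hq hr _ (soloInformedClamp_mem s)
  · simp only [C.slideVerts_of_le _ (not_lt.mp hr)]
    exact continuous_const

/-- The slide homotopy `(s, t) ↦ Γ_{m(s)}(t)` is jointly continuous. -/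
theorem continuous_gamma_slideVerts (hv : C.Adm v) (hq : C.Adm q) (hS : C.SlideOK v q) :
    Continuous fun p : ℝ × ℝ => C.gamma (C.slideVerts v q p.1) p.2 := by
  unfold gamma
  refine (((C.continuous_slideVerts hv hq 0).comp continuous_fst)).add
    (continuous_finsetSum _ fun r hr => ?_)
  have hr' : r < C.N := Finset.mem_range.mp hr
  refine Continuous.sub ?_ ((C.continuous_slideVerts hv hq r).comp continuous_fst)
  unfold piece soloInformedChartPiece
  refine (C.chart r).continuousOn.comp_continuous
    (soloInformed_continuous_segPoint
      ((continuous_apply _).comp ((C.continuous_slideVerts hv hq r).comp continuous_fst))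
      ((continuous_apply _).comp ((C.continuous_slideVerts hv hq (r + 1)).comp continuous_fst))
      ((continuous_soloInformedStep).comp continuous_snd)) fun p => ?_
  have ha := C.adm_slideVerts hv hq hS p.1
  exact segPoint_mem (convex_ball _ _) (C.chord_mem ha hr').1 (C.chord_mem ha hr').2
    (soloInformedStep_mem C.N_pos _)

/-- **The vertex-slide homotopy.** The chordal paths through `v` and through `q` are homotopic
on `Z(ℂ)` relative to the endpoints, whenever the slide condition holds and the end vertices
agree. -/
theorem homotopic_slide (hv : C.Adm v) (hq : C.Adm q) (hS : C.SlideOK v q) (h0 : q 0 = v 0)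
    (hN : q C.N = v C.N) (hv0 : ∀ i, IsAlgebraic ℚ (v 0 i)) (hvN : ∀ i, IsAlgebraic ℚ (v C.N i))
    (hq0 : ∀ i, IsAlgebraic ℚ (q 0 i)) (hqN : ∀ i, IsAlgebraic ℚ (q C.N i)) :
    SoloInformedHomotopic (C.curvePath hv hv0 hvN) (C.curvePath hq hq0 hqN) := by
  refine soloInformed_homotopic_of_homotopy _ _ (fun p => C.gamma (C.slideVerts v q p.1) p.2)
    (C.continuous_gamma_slideVerts hv hq hS) (fun s t ht => ?_) (fun t _ => ?_) (fun t _ => ?_)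
    (fun s => ?_) (fun s => ?_)
  · exact C.gamma_mem (C.adm_slideVerts hv hq hS s) ht
  · simp only [curvePath_toFun, C.slideVerts_zero hv]
  · simp only [curvePath_toFun, C.gamma_congr (C.slideVerts_one hq hN)]
  · simp only [curvePath_toFun]
    rw [C.gamma_zero (C.adm_slideVerts hv hq hS s), C.gamma_zero hv,
      C.slideVerts_of_lt s C.N_pos, h0, segPoint_self]
    exact (C.chart 0).apply_coord (hv.memΩ 0 C.N_pos) (hv.mem 0 (Nat.zero_le _))
  · simp only [curvePath_toFun]
    rw [C.gamma_one (C.adm_slideVerts hv hq hS s), C.gamma_one hv, C.slideVerts_of_le s le_rfl]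

end SoloInformedChain

end Summit.KontsevichZagierPeriods.KontsevichZagierPeriods.Theorems
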